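import Mathlib
import Summits.ValiantsHypothesis.ValiantsHypothesis.Theorems.ChowBorderDepth3ChowBorderBoundDefs

/-!
# Stub `stub_initialFormTransfer` of crux `ChowBorderDepth3.ChowBorderBound`
# (stmt-ValiantsHypothesis-5936), line `registered`

Stub W4 of the fan-in-two wave: the *torus degeneration* step of the lower bound.  Work in
`Â := MvPolynomial (Option σ) ℂ` (`σ := Fin n × Fin n`), whose distinguished variable
`τ := X none` is the torus parameter, and let
`θ := aeval (v ↦ τ^(wt v) · X (some v)) : MvPolynomial σ ℂ →ₐ[ℂ] Â` be the one-parameter torus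
action with weights `wt`, `red : Â →ₐ[ℂ] MvPolynomial σ ℂ` the reduction `τ ↦ 0`.  Suppose
`θ f = τ^W · f̂` with `f̂ := rename some f` (`f` is semi-invariant) and `θ g = τ^M · ĝ` with
`ĝ := rename some g₀ + τ · Q` (`g` degenerates to its initial form `g₀`).  Then, for a finite
family `Γ` of words `u` of length `t`, linear independence over `ℂ` of the quotient-derivative
numerators `qdn f g₀ u` implies that of the `qdn f g u`
(`qdn := QuotDeriv.quotDerivNum`, `qdn f g u = g^(|u|+1) ∂_u (f/g)`).

The statement takes as a hypothesis the (separately registered) calculus of stub W1: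
(a) `red` commutes with `qdn` along `some`-words, (b) a common factor `E` of numerator and
denominator comes out as `E^(|u|+1)`, (c) a denominator factor killed by every derivative of the
word comes out as `c^|u|`.  Only (a) and (c) are used.

## Proof

1. *Chain rule* `∂_{some v} (θ p) = τ^(wt v) · θ (∂_v p)` (induction on `p`), whence by induction
   on the word `τ^⟨wt,u⟩ · θ (qdn f g u) = qdn (θ f) (θ g) (u.map some)`.
2. Pulling out the `τ`-powers (`quotDerivNum_const_mul` for the numerator factor `τ^W`, W1(c) for
   the denominator factor `τ^M`): `τ^⟨wt,u⟩ · θ (qdn f g u) = τ^(W + M|u|) · qdn f̂ ĝ (u.map some)`.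
3. `red (qdn f̂ ĝ (u.map some)) = qdn (red f̂) (red ĝ) u = qdn f g₀ u` by W1(a), `red ∘ rename some
   = id` and `red τ = 0`.
4. *Transfer* (abstract lemma `linearIndependent_of_degeneration`): given a relation
   `Σ c_u · qdn f g u = 0` with some `c_u ≠ 0`, let `D` be the largest weight `⟨wt,u⟩` with
   `c_u ≠ 0`; apply `θ`, multiply by `τ^D`, cancel the non-zero-divisor `τ^(W + M t)` and reduce:
   the terms of weight `< D` die and what is left is a non-trivial relation among the `qdn f g₀ u`.
-/

-- `Summit.ValiantsHypothesis.ValiantsHypothesis.…` is the tree's mandated single-conjunct layout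
-- (Sub = Summit), so the duplicated namespace component is intended.
set_option linter.dupNamespace false

namespace Summit.ValiantsHypothesis.ValiantsHypothesis.Theorems.ChowBorderBound.InitialFormTransfer

open MvPolynomial Summit.ValiantsHypothesis.ValiantsHypothesis.Theorems.ChowBorderBound.QuotDeriv

/-- The matrix-variable derivatives kill every power of the torus parameter:
`∂_{some v} (τ^k) = 0`. [folklore] -/
theorem pderiv_some_X_none_pow {σ R : Type*} [CommRing R] (v : σ) (k : ℕ) :
    pderiv (some v) ((X none : MvPolynomial (Option σ) R) ^ k) = 0 := by
  rw [pderiv_pow, pderiv_X_of_ne (Option.some_ne_none v).symm, mul_zero]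

/-- Along a `some`-word every letter kills `τ^k`. [folklore] -/
theorem pderiv_X_none_pow_of_mem_map {σ R : Type*} [CommRing R] (k : ℕ) (u : List σ) :
    ∀ v ∈ u.map some, pderiv v ((X none : MvPolynomial (Option σ) R) ^ k) = 0 := by
  intro v hv
  obtain ⟨v, -, rfl⟩ := List.mem_map.1 hv
  exact pderiv_some_X_none_pow v k

/-- **Chain rule for the torus action** `θ = aeval (w ↦ τ^(wt w) · X (some w))`:
`∂_{some v} (θ p) = τ^(wt v) · θ (∂_v p)`. [folklore] -/
theorem pderiv_some_torus {σ R : Type*} [CommRing R] (wt : σ → ℕ) (v : σ)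
    (p : MvPolynomial σ R) :
    pderiv (some v)
        (aeval (fun w : σ => (X none : MvPolynomial (Option σ) R) ^ wt w * X (some w)) p) =
      (X none : MvPolynomial (Option σ) R) ^ wt v *
        aeval (fun w : σ => (X none : MvPolynomial (Option σ) R) ^ wt w * X (some w))
          (pderiv v p) := by
  induction p using MvPolynomial.induction_on with
  | C a => simp
  | add p q hp hq => simp only [map_add, hp, hq, mul_add]
  | mul_X p w hp =>
    simp only [map_mul, aeval_X, pderiv_mul, hp, pderiv_some_X_none_pow, zero_mul, zero_add,
      map_add]
    rcases eq_or_ne w v with rfl | hne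
    · rw [pderiv_X_self, pderiv_X_self, map_one]
      ring
    · rw [pderiv_X_of_ne hne, pderiv_X_of_ne (mt Option.some_inj.1 hne), map_zero]
      ring

/-- **Transport of quotient-derivative numerators along the torus action**: for a word `u`,
`τ^⟨wt,u⟩ · θ (qdn f g u) = qdn (θ f) (θ g) (u.map some)`. [folklore] -/
theorem torus_quotDerivNum {σ R : Type*} [CommRing R] (wt : σ → ℕ) (f g : MvPolynomial σ R)
    (u : List σ) :
    (X none : MvPolynomial (Option σ) R) ^ (u.map wt).sum *
        aeval (fun w : σ => (X none : MvPolynomial (Option σ) R) ^ wt w * X (some w))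
          (quotDerivNum f g u) =
      quotDerivNum
        (aeval (fun w : σ => (X none : MvPolynomial (Option σ) R) ^ wt w * X (some w)) f)
        (aeval (fun w : σ => (X none : MvPolynomial (Option σ) R) ^ wt w * X (some w)) g)
        (u.map some) := by
  induction u with
  | nil => simp
  | cons v u ih =>
    simp only [List.map_cons, List.sum_cons, quotDerivNum_cons, List.length_map, ← ih,
      pderiv_mul, pderiv_some_X_none_pow, pderiv_some_torus, map_sub, map_mul, map_add, map_one,
      map_natCast, nsmul_eq_mul, Nat.cast_add, Nat.cast_one, pow_add, zero_mul, zero_add]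
    ring

/-- Step 2 of the stub: if `θ f = τ^W · f̂` and `θ g = τ^M · ĝ`, then
`τ^⟨wt,u⟩ · θ (qdn f g u) = τ^W · (τ^M)^|u| · qdn f̂ ĝ (u.map some)`, GIVEN the rule (W1(c))
that a denominator factor constant along the word comes out as its `|u|`-th power. [folklore] -/
theorem torus_quotDerivNum_of_degeneration {σ : Type*} (wt : σ → ℕ) (f g : MvPolynomial σ ℂ)
    (F G : MvPolynomial (Option σ) ℂ) (W M : ℕ)
    (hconst : ∀ (c f g : MvPolynomial (Option σ) ℂ) (u : List (Option σ)),
      (∀ v ∈ u, pderiv v c = 0) → quotDerivNum f (c * g) u = c ^ u.length * quotDerivNum f g u)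
    (hf : aeval (fun w : σ => (X none : MvPolynomial (Option σ) ℂ) ^ wt w * X (some w)) f =
      (X none : MvPolynomial (Option σ) ℂ) ^ W * F)
    (hg : aeval (fun w : σ => (X none : MvPolynomial (Option σ) ℂ) ^ wt w * X (some w)) g =
      (X none : MvPolynomial (Option σ) ℂ) ^ M * G)
    (u : List σ) :
    (X none : MvPolynomial (Option σ) ℂ) ^ (u.map wt).sum *
        aeval (fun w : σ => (X none : MvPolynomial (Option σ) ℂ) ^ wt w * X (some w))
          (quotDerivNum f g u) =
      (X none : MvPolynomial (Option σ) ℂ) ^ W * ((X none : MvPolynomial (Option σ) ℂ) ^ M) ^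
        u.length * quotDerivNum F G (u.map some) := by
  rw [torus_quotDerivNum, hf, hg, quotDerivNum_const_mul _ _ _ _ (pderiv_X_none_pow_of_mem_map W u),
    hconst _ _ _ _ (pderiv_X_none_pow_of_mem_map M u), List.length_map, mul_assoc]

/-- The reduction `τ ↦ 0` is a retraction of the inclusion `rename some`. [folklore] -/
theorem red_rename_some {σ R : Type*} [CommRing R] (p : MvPolynomial σ R) :
    aeval (fun o : Option σ => o.elim (0 : MvPolynomial σ R) X) (rename some p) = p := by
  rw [aeval_rename]
  exact aeval_X_left_apply p

/-- **Abstract initial-form transfer of linear independence.**  Let `θ : P → A`, `red : A → P`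
be algebra maps over a field `K`, `τ ∈ A` a non-zero element of the domain `A` with `red τ = 0`,
and let `F G : I → P`, `Z : I → A` be finite families with `τ^(d i) · θ (F i) = τ^N · Z i` and
`red (Z i) = G i`.  If the "initial forms" `G` are linearly independent, so are the `F`.
[folklore] -/
theorem linearIndependent_of_degeneration {K I P A : Type*} [Field K] [Fintype I] [CommRing P]
    [Algebra K P] [CommRing A] [IsDomain A] [Algebra K A] (θ : P →ₐ[K] A) (red : A →ₐ[K] P)
    (τ : A) (hτ : τ ≠ 0) (hred : red τ = 0) (F G : I → P) (Z : I → A) (d : I → ℕ) (N : ℕ)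
    (hF : ∀ i, τ ^ d i * θ (F i) = τ ^ N * Z i) (hZ : ∀ i, red (Z i) = G i)
    (hG : LinearIndependent K G) : LinearIndependent K F := by
  classical
  rw [Fintype.linearIndependent_iff] at hG ⊢
  intro c hc
  by_contra! hne
  -- `i₀`: an index in the support of `c` of largest weight `d`
  obtain ⟨i₀, hi₀, hmax⟩ := Finset.exists_max_image (Finset.univ.filter fun i => c i ≠ 0) d
    (let ⟨i, hi⟩ := hne; ⟨i, Finset.mem_filter.2 ⟨Finset.mem_univ _, hi⟩⟩)
  have hi₀' : c i₀ ≠ 0 := (Finset.mem_filter.1 hi₀).2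
  have hmax' : ∀ i, c i ≠ 0 → d i ≤ d i₀ := fun i hi =>
    hmax i (Finset.mem_filter.2 ⟨Finset.mem_univ _, hi⟩)
  -- apply `θ` to the relation and multiply by `τ ^ d i₀`
  have h1 : ∑ i, c i • (τ ^ d i₀ * θ (F i)) = 0 := by
    have := congrArg (fun p => τ ^ d i₀ * θ p) hc
    simpa only [map_sum, map_smul, Finset.mul_sum, mul_smul_comm, map_zero, mul_zero] using this
  have h2 : ∀ i, c i • (τ ^ d i₀ * θ (F i)) = τ ^ N * (c i • (τ ^ (d i₀ - d i) * Z i)) := by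
    intro i
    by_cases hci : c i = 0
    · simp [hci]
    · obtain ⟨k, hk⟩ := Nat.exists_eq_add_of_le (hmax' i hci)
      rw [hk, Nat.add_sub_cancel_left, Algebra.smul_def, Algebra.smul_def, pow_add]
      calc algebraMap K A (c i) * (τ ^ d i * τ ^ k * θ (F i))
          = algebraMap K A (c i) * τ ^ k * (τ ^ d i * θ (F i)) := by ring
        _ = algebraMap K A (c i) * τ ^ k * (τ ^ N * Z i) := by rw [hF i]
        _ = τ ^ N * (algebraMap K A (c i) * (τ ^ k * Z i)) := by ring
  have h3 : τ ^ N * ∑ i, c i • (τ ^ (d i₀ - d i) * Z i) = 0 := by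
    rw [Finset.mul_sum, ← h1]
    exact Finset.sum_congr rfl fun i _ => (h2 i).symm
  have h4 : ∑ i, c i • (τ ^ (d i₀ - d i) * Z i) = 0 :=
    (mul_eq_zero.1 h3).resolve_left (pow_ne_zero _ hτ)
  -- reduce: only the indices of top weight survive
  have h5 : ∑ i, (if d i₀ ≤ d i then c i else 0) • G i = 0 := by
    have h := congrArg red h4
    rw [map_sum, map_zero] at h
    rw [← h]
    refine Finset.sum_congr rfl fun i _ => ?_
    rw [map_smul, map_mul, map_pow, hred, hZ]
    by_cases h : d i₀ ≤ d i
    · rw [if_pos h, Nat.sub_eq_zero_of_le h, pow_zero, one_mul]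
    · rw [if_neg h, zero_pow (Nat.sub_ne_zero_of_lt (not_le.1 h)), zero_mul, smul_zero, zero_smul]
  have h6 := hG _ h5 i₀
  rw [if_pos le_rfl] at h6
  exact hi₀' h6

/-- **Stub `stub_initialFormTransfer`** (W4; registered stub of crux stmt-ValiantsHypothesis-5936,
line `registered`): assuming the quotient-derivative calculus W1, the torus degeneration
`θ f = τ^W f̂`, `θ g = τ^M (ĝ₀ + τ Q)` transfers linear independence of the family
`u ↦ qdn f g₀ u` (`u ∈ Γ`, words of length `t`) to the family `u ↦ qdn f g u`. -/
theorem stub_initialFormTransfer :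
    ((∀ (n : ℕ) (f g : MvPolynomial (Option (Fin n × Fin n)) ℂ) (u : List (Fin n × Fin n)),
      MvPolynomial.aeval (fun o : Option (Fin n × Fin n) => o.elim (0 : MvPolynomial (Fin n × Fin n) ℂ) MvPolynomial.X)
          (Summit.ValiantsHypothesis.ValiantsHypothesis.Theorems.ChowBorderBound.QuotDeriv.quotDerivNum f g (u.map some)) =
        Summit.ValiantsHypothesis.ValiantsHypothesis.Theorems.ChowBorderBound.QuotDeriv.quotDerivNum
          (MvPolynomial.aeval (fun o : Option (Fin n × Fin n) => o.elim (0 : MvPolynomial (Fin n × Fin n) ℂ) MvPolynomial.X) f)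
          (MvPolynomial.aeval (fun o : Option (Fin n × Fin n) => o.elim (0 : MvPolynomial (Fin n × Fin n) ℂ) MvPolynomial.X) g) u) ∧
    (∀ (ι : Type) (f g E : MvPolynomial ι ℂ) (u : List ι),
      Summit.ValiantsHypothesis.ValiantsHypothesis.Theorems.ChowBorderBound.QuotDeriv.quotDerivNum (f * E) (g * E) u =
        E ^ (u.length + 1) * Summit.ValiantsHypothesis.ValiantsHypothesis.Theorems.ChowBorderBound.QuotDeriv.quotDerivNum f g u) ∧
    (∀ (ι : Type) (c f g : MvPolynomial ι ℂ) (u : List ι), (∀ v ∈ u, MvPolynomial.pderiv v c = 0) →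
      Summit.ValiantsHypothesis.ValiantsHypothesis.Theorems.ChowBorderBound.QuotDeriv.quotDerivNum f (c * g) u =
        c ^ u.length * Summit.ValiantsHypothesis.ValiantsHypothesis.Theorems.ChowBorderBound.QuotDeriv.quotDerivNum f g u)) →
    ∀ (n : ℕ) (wt : Fin n × Fin n → ℕ) (f g g₀ : MvPolynomial (Fin n × Fin n) ℂ) (W M : ℕ)
      (Q : MvPolynomial (Option (Fin n × Fin n)) ℂ),
      MvPolynomial.aeval (fun v : Fin n × Fin n => (MvPolynomial.X (none : Option (Fin n × Fin n)) : MvPolynomial (Option (Fin n × Fin n)) ℂ) ^ wt v * MvPolynomial.X (some v)) f =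
        (MvPolynomial.X (none : Option (Fin n × Fin n)) : MvPolynomial (Option (Fin n × Fin n)) ℂ) ^ W * MvPolynomial.rename some f →
      MvPolynomial.aeval (fun v : Fin n × Fin n => (MvPolynomial.X (none : Option (Fin n × Fin n)) : MvPolynomial (Option (Fin n × Fin n)) ℂ) ^ wt v * MvPolynomial.X (some v)) g =
        (MvPolynomial.X (none : Option (Fin n × Fin n)) : MvPolynomial (Option (Fin n × Fin n)) ℂ) ^ M * (MvPolynomial.rename some g₀ + (MvPolynomial.X (none : Option (Fin n × Fin n)) : MvPolynomial (Option (Fin n × Fin n)) ℂ) * Q) →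
      ∀ (t : ℕ) (Γ : Finset (Fin t → Fin n × Fin n)),
        LinearIndependent ℂ (fun u : Γ =>
          Summit.ValiantsHypothesis.ValiantsHypothesis.Theorems.ChowBorderBound.QuotDeriv.quotDerivNum f g₀ (List.ofFn fun k => u.1 k)) →
        LinearIndependent ℂ (fun u : Γ =>
          Summit.ValiantsHypothesis.ValiantsHypothesis.Theorems.ChowBorderBound.QuotDeriv.quotDerivNum f g (List.ofFn fun k => u.1 k)) := by
  rintro ⟨hred, -, hconst⟩ n wt f g g₀ W M Q hf hg t Γ hind
  refine linearIndependent_of_degeneration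
    (MvPolynomial.aeval fun v : Fin n × Fin n =>
      (MvPolynomial.X (none : Option (Fin n × Fin n)) : MvPolynomial (Option (Fin n × Fin n)) ℂ) ^
        wt v * MvPolynomial.X (some v))
    (MvPolynomial.aeval fun o : Option (Fin n × Fin n) =>
      o.elim (0 : MvPolynomial (Fin n × Fin n) ℂ) MvPolynomial.X)
    (MvPolynomial.X none) (MvPolynomial.X_ne_zero _) (by simp) _ _
    (fun u => quotDerivNum (rename some f) (rename some g₀ + X none * Q)
      ((List.ofFn fun k => u.1 k).map some))
    (fun u => ((List.ofFn fun k => u.1 k).map wt).sum) (W + M * t) (fun u => ?_) (fun u => ?_)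
    hind
  · -- Steps 1–2: transport along the torus action and pull out the `τ`-powers
    rw [torus_quotDerivNum_of_degeneration wt f g _ _ W M (hconst _) hf hg, List.length_ofFn,
      ← pow_mul, pow_add]
  · -- Step 3: reduction modulo `τ`
    rw [hred, red_rename_some, map_add, map_mul, red_rename_some, MvPolynomial.aeval_X,
      Option.elim_none, zero_mul, add_zero]

end Summit.ValiantsHypothesis.ValiantsHypothesis.Theorems.ChowBorderBound.InitialFormTransfer
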